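import Summits.AtomisticToContinuum.Crystallization.Theorems.PricedLinkCensusTruncatedCensusGapLandscapeCertDefs

/-!
# Landscape certificates for the near/far split of `TruncatedCensusGap` — kernel runs H1 (`F_hcp` floor, part 1/4)

Route `PricedLinkCensus`, crux `TruncatedCensusGap` (stmt-AtomisticToContinuum-14230), line `near-far-split`
(reshape r2 of lead c5): the landscape package N1c on the class sums `F_fcc`, `F_hcp` of `V_χ` (see
`…LandscapeCertDefs`).  This file: kernel runs of the `F_hcp` floor (C3) on leaves of a quadtree of the window (part 1 of 4; the leaves are glued in `…LandscapePackage`).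
-/

noncomputable section

namespace Summit.AtomisticToContinuum.Crystallization.Theorems.PricedLinkCensusTruncatedCensusGap.StrainedMargin

/-! ## Kernel runs: the `F_hcp` floor (C3), part 1 -/

set_option maxHeartbeats 0 in -- kernel evaluation of a box certificate (no proof search; bounded by the box count)
/-- Kernel run: `HCP` floor (`lam = 5`, `ε = 10⁻⁶`) on the sub-box `[8649 / 10000, 19053 / 20000] × [1521 / 2500, 337 / 500]`
(349 boxes). [folklore] -/
theorem floorH_b1 : checkFloor 5 (1 / 1000000) HCP 10 (8649 / 10000) (19053 / 20000) (1521 / 2500) (337 / 500) = true := by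
  decide +kernel

set_option maxHeartbeats 0 in -- kernel evaluation of a box certificate (no proof search; bounded by the box count)
/-- Kernel run: `HCP` floor (`lam = 5`, `ε = 10⁻⁶`) on the sub-box `[8649 / 10000, 36351 / 40000] × [337 / 500, 1767 / 2500]`
(13 boxes). [folklore] -/
theorem floorH_b2 : checkFloor 5 (1 / 1000000) HCP 4 (8649 / 10000) (36351 / 40000) (337 / 500) (1767 / 2500) = true := by
  decide +kernel

set_option maxHeartbeats 0 in -- kernel evaluation of a box certificate (no proof search; bounded by the box count)
/-- Kernel run: `HCP` floor (`lam = 5`, `ε = 10⁻⁶`) on the sub-box `[8649 / 10000, 36351 / 40000] × [1767 / 2500, 1849 / 2500]`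
(13 boxes). [folklore] -/
theorem floorH_b3 : checkFloor 5 (1 / 1000000) HCP 4 (8649 / 10000) (36351 / 40000) (1767 / 2500) (1849 / 2500) = true := by
  decide +kernel

set_option maxHeartbeats 0 in -- kernel evaluation of a box certificate (no proof search; bounded by the box count)
/-- Kernel run: `HCP` floor (`lam = 5`, `ε = 10⁻⁶`) on the sub-box `[36351 / 40000, 19053 / 20000] × [337 / 500, 1767 / 2500]`
(357 boxes). [folklore] -/
theorem floorH_b4 : checkFloor 5 (1 / 1000000) HCP 8 (36351 / 40000) (19053 / 20000) (337 / 500) (1767 / 2500) = true := by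
  decide +kernel

set_option maxHeartbeats 0 in -- kernel evaluation of a box certificate (no proof search; bounded by the box count)
/-- Kernel run: `HCP` floor (`lam = 5`, `ε = 10⁻⁶`) on the sub-box `[36351 / 40000, 19053 / 20000] × [1767 / 2500, 1849 / 2500]`
(173 boxes). [folklore] -/
theorem floorH_b5 : checkFloor 5 (1 / 1000000) HCP 6 (36351 / 40000) (19053 / 20000) (1767 / 2500) (1849 / 2500) = true := by
  decide +kernel


end Summit.AtomisticToContinuum.Crystallization.Theorems.PricedLinkCensusTruncatedCensusGap.StrainedMargin
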